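import Mathlib.RingTheory.MvPolynomial.EulerIdentity
import Mathlib.Tactic.Ring
import Mathlib.Tactic.NormNum
import Summits.BirchSwinnertonDyer.BirchSwinnertonDyer.Theorems.Rank2ShaThetaJet
import HarnessLib

/-!
# BirchSwinnertonDyer — rank-2 `Ш[p^∞]` cell, STRUCTURE track: the μ₆ / μ₄ supports of the `θ`-jets at ALL orders (T21b)

HONEST FRAMING (cell `b2b-bsdr2sha`, run/shared/lean/b2b/bsd-rank2-sha/; LEAD g12, HOME/INBOX.md l.1004: «(a) T21b (supports for all
n by weighted homogeneity) is a genuine theorem and welcome after T22»): COMMUTATIVE ALGEBRA ONLY. T21 (`Rank2ShaThetaJet`, Part B (iii))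
certified by `decide` the vanishing pattern of the jets `θⁿQ, θⁿR, θⁿP, θⁿj` at the two CM points for `n ≤ 12`; this file PROVES the
pattern for EVERY `n`, for T21's derivation `D = 12θ` of `ℤ[P,Q,R,S]` (Part A), from the modular WEIGHT GRADING:
`wt(P,Q,R,S) = (2, 4, 6, −12)` [`wt`] (`E₂, E₄, E₆` have weights `2, 4, 6`; `S = Δ⁻¹` has weight `−12`).
* `D = Σᵢ dVal i · ∂ᵢ` [`D_eq`] and each `dVal i` is weighted-homogeneous of weight `wt i + 2` [`isWeightedHomogeneous_dVal`], hence
  **`D` raises weights by `2`** [`isWeightedHomogeneous_D`] and `D^k` by `2k` [`isWeightedHomogeneous_iterate_D`]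
  (Mathlib `MvPolynomial.IsWeightedHomogeneous`, `IsWeightedHomogeneous.pderiv`).
* A weighted-homogeneous form whose weight is NOT a multiple of `6` vanishes at every point with `P = Q = 0` (only monomials `RᶜSᵈ`,
  of weight `6c − 12d`, survive there) [`eval_eq_zero_of_P_Q`]; likewise weight `∉ 4ℤ` ⇒ vanishing at every point with `P = R = 0`
  (monomials `QᵇSᵈ`, weight `4b − 12d`) [`eval_eq_zero_of_P_R`].
* Consequences (the μ₆ / μ₄ SUPPORTS, all `k`): at any point with `P = Q = 0` — in particular T21's CM point `j = 0`, `(0,0,1,−1728)` —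
  `DᵏQ = 0` unless `k ≡ 1 (mod 3)`, `DᵏR = 0` unless `k ≡ 0`, `DᵏP = 0` unless `k ≡ 2`, `Dᵏ(Q³S) = 0` unless `k ≡ 0 (mod 3)`
  [`iterate_D_Q_eval_J0` … `iterate_D_j_eval_J0`]; at any point with `P = R = 0` — in particular `j = 1728`, `(0,1,0,1728)` —
  `DᵏQ = 0` for odd `k`, `DᵏR = 0` and `DᵏP = 0` for even `k`, `Dᵏ(Q³S − 1728) = 0` for odd `k` [`…_J1728`]. Since `θ = D/12`, the same
  holds for `θᵏ`; at T21's two CM points [`cmJ0`, `cmJ1728`, `cm_supports_J0`, `cm_supports_J1728`]. The converse non-vanishing at the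
  allowed residues (and `j`'s triple / double zero) is what T21's tables show for `k ≤ 12`.

NOT TYPED: anything analytic (Katz `d/dτ = θ`, CM theory — WHY `E₂, E₄` resp. `E₂, E₆` vanish at the CM points is the μ₆/μ₄ action on
the fibre, taken here as the DEFINITION of the two points); nothing on BSD, `Ш`, heights. No named fact, no axiom, no `sorry`.
References: T21 `Rank2ShaThetaJet` (p385294); Mathlib `RingTheory.MvPolynomial.WeightedHomogeneous` / `EulerIdentity`
(`IsWeightedHomogeneous.pderiv`); the ten-line `derivation_ext` argument for `D_eq` is adapted from
`Literature/NumberTheory/Transcendental/ArithPoly.lean` (`mkDerivation_apply_eq_sum_mul`, there over a field).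
-/

set_option autoImplicit false

-- single-conjunct summit: `Summit.BirchSwinnertonDyer.BirchSwinnertonDyer.…` repeats the name by design
set_option linter.dupNamespace false

namespace Summit.BirchSwinnertonDyer.BirchSwinnertonDyer.Rank2Sha.Structure.ThetaJet

open MvPolynomial

/-- the modular weights: `P ↦ 2`, `Q ↦ 4`, `R ↦ 6`, `S ↦ −12` -/
def wt : Gen → ℤ
  | .P => 2
  | .Q => 4
  | .R => 6
  | .S => -12

/-- **`D = Σᵢ dVal i · ∂/∂Xᵢ`** on `ℤ[P,Q,R,S]` (two derivations agreeing on the generators are equal). -/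
theorem D_eq (φ : R₄) :
    D φ = dVal .P * pderiv .P φ + dVal .Q * pderiv .Q φ + dVal .R * pderiv .R φ + dVal .S * pderiv .S φ := by
  have hD : D = dVal .P • (pderiv .P : Derivation ℤ R₄ R₄) + dVal .Q • (pderiv .Q : Derivation ℤ R₄ R₄) +
      dVal .R • (pderiv .R : Derivation ℤ R₄ R₄) + dVal .S • (pderiv .S : Derivation ℤ R₄ R₄) := by
    refine MvPolynomial.derivation_ext fun j => ?_
    cases j <;>
      simp [Derivation.add_apply, Derivation.smul_apply, pderiv_X_self, pderiv_X_of_ne, smul_eq_mul, dVal]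
  have h := congrArg (fun E : Derivation ℤ R₄ R₄ => E φ) hD
  simpa [Derivation.add_apply, Derivation.smul_apply, smul_eq_mul] using h

/-- the generator `Xᵢ` has weight `wt i` -/
theorem isWeightedHomogeneous_gen (i : Gen) : IsWeightedHomogeneous wt (X i : R₄) (wt i) :=
  isWeightedHomogeneous_X ℤ wt i

/-- the difference of two forms of weight `n` has weight `n` -/
private theorem iwh_sub {φ ψ : R₄} {n : ℤ} (h₁ : IsWeightedHomogeneous wt φ n) (h₂ : IsWeightedHomogeneous wt ψ n) :
    IsWeightedHomogeneous wt (φ - ψ) n :=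
  (weightedHomogeneousSubmodule ℤ wt n).sub_mem h₁ h₂

/-- the negative of a form of weight `n` has weight `n` -/
private theorem iwh_neg {φ : R₄} {n : ℤ} (h : IsWeightedHomogeneous wt φ n) : IsWeightedHomogeneous wt (-φ) n :=
  (weightedHomogeneousSubmodule ℤ wt n).neg_mem h

/-- a numeral multiple of a form of weight `n` has weight `n` -/
private theorem iwh_ofNat_mul (k : ℕ) [k.AtLeastTwo] {φ : R₄} {n : ℤ} (h : IsWeightedHomogeneous wt φ n) :
    IsWeightedHomogeneous wt (ofNat(k) * φ) n := by
  have h' := (isWeightedHomogeneous_C wt (ofNat(k) : ℤ)).mul h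
  rwa [map_ofNat, zero_add] at h'

/-- **each `dVal i = D Xᵢ` is weighted-homogeneous of weight `wt i + 2`**: `P² − Q` (4), `4(PQ − R)` (6), `6(PR − Q²)` (8),
`−12PS` (−10). -/
theorem isWeightedHomogeneous_dVal (i : Gen) : IsWeightedHomogeneous wt (dVal i) (wt i + 2) := by
  have hP := isWeightedHomogeneous_gen .P
  have hQ := isWeightedHomogeneous_gen .Q
  have hR := isWeightedHomogeneous_gen .R
  have hS := isWeightedHomogeneous_gen .S
  cases i with
  | P => exact iwh_sub (hP.mul hP) hQ
  | Q => exact iwh_ofNat_mul 4 (iwh_sub (hP.mul hQ) hR)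
  | R => exact iwh_ofNat_mul 6 (iwh_sub (hP.mul hR) (hQ.mul hQ))
  | S => exact iwh_neg (iwh_ofNat_mul 12 (hP.mul hS))

/-- **`D` raises weights by `2`.** -/
theorem isWeightedHomogeneous_D {φ : R₄} {n : ℤ} (h : IsWeightedHomogeneous wt φ n) :
    IsWeightedHomogeneous wt (D φ) (n + 2) := by
  have key : ∀ i, IsWeightedHomogeneous wt (dVal i * pderiv i φ) (n + 2) := fun i => by
    have h₁ : IsWeightedHomogeneous wt (pderiv i φ) (n - wt i) := h.pderiv (sub_add_cancel n (wt i))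
    have h₂ := (isWeightedHomogeneous_dVal i).mul h₁
    convert h₂ using 1
    ring
  rw [D_eq]
  exact (((key .P).add (key .Q)).add (key .R)).add (key .S)

/-- **`Dᵏ` raises weights by `2k`.** -/
theorem isWeightedHomogeneous_iterate_D (k : ℕ) {φ : R₄} {n : ℤ} (h : IsWeightedHomogeneous wt φ n) :
    IsWeightedHomogeneous wt ((⇑D)^[k] φ) (n + 2 * k) := by
  induction k with
  | zero => simpa using h
  | succ k ih =>
    rw [Function.iterate_succ_apply']
    convert isWeightedHomogeneous_D ih using 1
    push_cast
    ring

/-- **Weight `∉ 6ℤ` ⇒ vanishing wherever `P = Q = 0`** (the surviving monomials `RᶜSᵈ` have weight `6c − 12d`). -/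
theorem eval_eq_zero_of_P_Q {φ : R₄} {n : ℤ} (h : IsWeightedHomogeneous wt φ n) (hn : ¬ (6 : ℤ) ∣ n) (f : Gen → ℤ)
    (hP : f .P = 0) (hQ : f .Q = 0) : eval f φ = 0 := by
  rw [eval_eq]
  refine Finset.sum_eq_zero fun d hd => ?_
  by_cases hdP : d .P = 0
  · by_cases hdQ : d .Q = 0
    · exfalso
      apply hn
      rw [← h (mem_support_iff.mp hd), Finsupp.weight_apply, Finsupp.sum]
      refine Finset.dvd_sum fun i hi => ?_
      cases i with
      | P => exact absurd hdP (Finsupp.mem_support_iff.mp hi)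
      | Q => exact absurd hdQ (Finsupp.mem_support_iff.mp hi)
      | R => exact ⟨d .R, by simp [wt, mul_comm]⟩
      | S => exact ⟨-2 * d .S, by simp [wt]; ring⟩
    · rw [Finset.prod_eq_zero (Finsupp.mem_support_iff.mpr hdQ) (by rw [hQ, zero_pow hdQ]), mul_zero]
  · rw [Finset.prod_eq_zero (Finsupp.mem_support_iff.mpr hdP) (by rw [hP, zero_pow hdP]), mul_zero]

/-- **Weight `∉ 4ℤ` ⇒ vanishing wherever `P = R = 0`** (the surviving monomials `QᵇSᵈ` have weight `4b − 12d`). -/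
theorem eval_eq_zero_of_P_R {φ : R₄} {n : ℤ} (h : IsWeightedHomogeneous wt φ n) (hn : ¬ (4 : ℤ) ∣ n) (f : Gen → ℤ)
    (hP : f .P = 0) (hR : f .R = 0) : eval f φ = 0 := by
  rw [eval_eq]
  refine Finset.sum_eq_zero fun d hd => ?_
  by_cases hdP : d .P = 0
  · by_cases hdR : d .R = 0
    · exfalso
      apply hn
      rw [← h (mem_support_iff.mp hd), Finsupp.weight_apply, Finsupp.sum]
      refine Finset.dvd_sum fun i hi => ?_
      cases i with
      | P => exact absurd hdP (Finsupp.mem_support_iff.mp hi)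
      | Q => exact ⟨d .Q, by simp [wt, mul_comm]⟩
      | R => exact absurd hdR (Finsupp.mem_support_iff.mp hi)
      | S => exact ⟨-3 * d .S, by simp [wt]; ring⟩
    · rw [Finset.prod_eq_zero (Finsupp.mem_support_iff.mpr hdR) (by rw [hR, zero_pow hdR]), mul_zero]
  · rw [Finset.prod_eq_zero (Finsupp.mem_support_iff.mpr hdP) (by rw [hP, zero_pow hdP]), mul_zero]

/-- `j = Q³S` has weight `0` -/
theorem isWeightedHomogeneous_j : IsWeightedHomogeneous wt (X .Q ^ 3 * X .S : R₄) 0 := by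
  have h := ((isWeightedHomogeneous_gen .Q).pow 3).mul (isWeightedHomogeneous_gen .S)
  convert h using 1
  simp [wt]

/-- `j − 1728 = Q³S − 1728` has weight `0` -/
theorem isWeightedHomogeneous_jm : IsWeightedHomogeneous wt (X .Q ^ 3 * X .S - C 1728 : R₄) 0 :=
  iwh_sub isWeightedHomogeneous_j (isWeightedHomogeneous_C wt 1728)

/-! ### The supports at ALL orders -/

section J0
variable (k : ℕ) (f : Gen → ℤ) (hP : f .P = 0) (hQ : f .Q = 0)
include hP hQ

/-- **μ₆, `c₄`-jet**: at any point with `P = Q = 0` (e.g. `j = 0`), `DᵏQ` vanishes unless `k ≡ 1 (mod 3)`. -/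
theorem iterate_D_Q_eval_J0 (hk : k % 3 ≠ 1) : eval f ((⇑D)^[k] (X .Q)) = 0 :=
  eval_eq_zero_of_P_Q (isWeightedHomogeneous_iterate_D k (isWeightedHomogeneous_gen .Q)) (by simp [wt]; omega) f hP hQ

/-- **μ₆, `E₆`-jet**: at any point with `P = Q = 0`, `DᵏR` vanishes unless `k ≡ 0 (mod 3)`. -/
theorem iterate_D_R_eval_J0 (hk : k % 3 ≠ 0) : eval f ((⇑D)^[k] (X .R)) = 0 :=
  eval_eq_zero_of_P_Q (isWeightedHomogeneous_iterate_D k (isWeightedHomogeneous_gen .R)) (by simp [wt]; omega) f hP hQ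

/-- **μ₆, `E₂`-jet**: at any point with `P = Q = 0`, `DᵏP` vanishes unless `k ≡ 2 (mod 3)`. -/
theorem iterate_D_P_eval_J0 (hk : k % 3 ≠ 2) : eval f ((⇑D)^[k] (X .P)) = 0 :=
  eval_eq_zero_of_P_Q (isWeightedHomogeneous_iterate_D k (isWeightedHomogeneous_gen .P)) (by simp [wt]; omega) f hP hQ

/-- **μ₆, `j`-jet**: at any point with `P = Q = 0`, `Dᵏ(Q³S)` vanishes unless `k ≡ 0 (mod 3)`. -/
theorem iterate_D_j_eval_J0 (hk : k % 3 ≠ 0) : eval f ((⇑D)^[k] (X .Q ^ 3 * X .S)) = 0 :=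
  eval_eq_zero_of_P_Q (isWeightedHomogeneous_iterate_D k isWeightedHomogeneous_j) (by simp; omega) f hP hQ

end J0

section J1728
variable (k : ℕ) (f : Gen → ℤ) (hP : f .P = 0) (hR : f .R = 0)
include hP hR

/-- **μ₄, `c₄`-jet**: at any point with `P = R = 0` (e.g. `j = 1728`), `DᵏQ` vanishes for odd `k`. -/
theorem iterate_D_Q_eval_J1728 (hk : k % 2 = 1) : eval f ((⇑D)^[k] (X .Q)) = 0 :=
  eval_eq_zero_of_P_R (isWeightedHomogeneous_iterate_D k (isWeightedHomogeneous_gen .Q)) (by simp [wt]; omega) f hP hR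

/-- **μ₄, `E₆`-jet**: at any point with `P = R = 0`, `DᵏR` vanishes for even `k`. -/
theorem iterate_D_R_eval_J1728 (hk : k % 2 = 0) : eval f ((⇑D)^[k] (X .R)) = 0 :=
  eval_eq_zero_of_P_R (isWeightedHomogeneous_iterate_D k (isWeightedHomogeneous_gen .R)) (by simp [wt]; omega) f hP hR

/-- **μ₄, `E₂`-jet**: at any point with `P = R = 0`, `DᵏP` vanishes for even `k`. -/
theorem iterate_D_P_eval_J1728 (hk : k % 2 = 0) : eval f ((⇑D)^[k] (X .P)) = 0 :=
  eval_eq_zero_of_P_R (isWeightedHomogeneous_iterate_D k (isWeightedHomogeneous_gen .P)) (by simp [wt]; omega) f hP hR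

/-- **μ₄, `(j − 1728)`-jet**: at any point with `P = R = 0`, `Dᵏ(Q³S − 1728)` vanishes for odd `k`. -/
theorem iterate_D_jm_eval_J1728 (hk : k % 2 = 1) : eval f ((⇑D)^[k] (X .Q ^ 3 * X .S - C 1728)) = 0 :=
  eval_eq_zero_of_P_R (isWeightedHomogeneous_iterate_D k isWeightedHomogeneous_jm) (by simp; omega) f hP hR

end J1728

/-- T21's CM point `j = 0` as an integer point: `(P,Q,R,S) = (0,0,1,−1728)` -/
def cmJ0 : Gen → ℤ
  | .P => 0
  | .Q => 0
  | .R => 1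
  | .S => -1728

/-- T21's CM point `j = 1728` as an integer point: `(P,Q,R,S) = (0,1,0,1728)` -/
def cmJ1728 : Gen → ℤ
  | .P => 0
  | .Q => 1
  | .R => 0
  | .S => 1728

/-- **The μ₆ supports at `j = 0`, every order `k`** (T21 `jetSupport_J0` was `k ≤ 12`): `DᵏQ`, `DᵏR`, `DᵏP`, `Dᵏj` vanish at
`(0,0,1,−1728)` unless `k ≡ 1, 0, 2, 0 (mod 3)` respectively. -/
theorem cm_supports_J0 (k : ℕ) :
    (k % 3 ≠ 1 → eval cmJ0 ((⇑D)^[k] (X .Q)) = 0) ∧ (k % 3 ≠ 0 → eval cmJ0 ((⇑D)^[k] (X .R)) = 0) ∧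
    (k % 3 ≠ 2 → eval cmJ0 ((⇑D)^[k] (X .P)) = 0) ∧ (k % 3 ≠ 0 → eval cmJ0 ((⇑D)^[k] (X .Q ^ 3 * X .S)) = 0) :=
  ⟨iterate_D_Q_eval_J0 k cmJ0 rfl rfl, iterate_D_R_eval_J0 k cmJ0 rfl rfl, iterate_D_P_eval_J0 k cmJ0 rfl rfl,
    iterate_D_j_eval_J0 k cmJ0 rfl rfl⟩

/-- **The μ₄ supports at `j = 1728`, every order `k`** (T21 `jetSupport_J1728` was `k ≤ 12`): `DᵏQ` vanishes at `(0,1,0,1728)` for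
odd `k`; `DᵏR`, `DᵏP` for even `k`; `Dᵏ(j − 1728)` for odd `k`. -/
theorem cm_supports_J1728 (k : ℕ) :
    (k % 2 = 1 → eval cmJ1728 ((⇑D)^[k] (X .Q)) = 0) ∧ (k % 2 = 0 → eval cmJ1728 ((⇑D)^[k] (X .R)) = 0) ∧
    (k % 2 = 0 → eval cmJ1728 ((⇑D)^[k] (X .P)) = 0) ∧ (k % 2 = 1 → eval cmJ1728 ((⇑D)^[k] (X .Q ^ 3 * X .S - C 1728)) = 0) :=
  ⟨iterate_D_Q_eval_J1728 k cmJ1728 rfl rfl, iterate_D_R_eval_J1728 k cmJ1728 rfl rfl, iterate_D_P_eval_J1728 k cmJ1728 rfl rfl,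
    iterate_D_jm_eval_J1728 k cmJ1728 rfl rfl⟩

end Summit.BirchSwinnertonDyer.BirchSwinnertonDyer.Rank2Sha.Structure.ThetaJet
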